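import Summits.ResolutionOfSingularities.ResolutionOfSingularities.Theorems.FrobeniusLadderFInjectiveMacaulayficationOfFullBlowupGe4
import Summits.ResolutionOfSingularities.ResolutionOfSingularities.Theorems.FrobeniusLadderFInjectiveMacaulayficationFTemkinClosedPointsLocal
import Summits.ResolutionOfSingularities.ResolutionOfSingularities.Theorems.FrobeniusLadderFInjectiveMacaulayficationRegularOffFiniteOfLRFibre
import Summits.ResolutionOfSingularities.ResolutionOfSingularities.Theorems.FrobeniusLadderFInjectiveMacaulayficationLocalFullificationFibreClosedGe4
import HarnessLib

/-!
# THE CRUX FROM THE WEAK (♭) LOCAL DOOR: `FInjectiveMacaulayfication` ⟸ {CP 1.1, R–G 081R, CP 4.4} ∧ (LR♭) ∧ (LF_cl) — door v36's `_proof` term on the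
# WEAKEST registered pair (crux `FInjectiveMacaulayfication` stmt-ResolutionOfSingularities-15315, chain w45a; res-L1-w45a-plan-1 R17.6 (2) / STEER
# 00:15:19Z «v36 registers the weakest pair directly»; seat res-L1-w45a-stub-3 g7)

[OURS · L1 W4.5a] Support file (`--supports stmt-ResolutionOfSingularities-15315 --as helper`); NOT a statement of any manuscript; def-free; CONDITIONAL on
the three printed theorems BY NAME (`CossartPiltant2019General`, `Stacks081R`, `CossartPiltant2019Principalization`) and on the chain's two CANDIDATE local
statements (L·R♭) `RegularOffFiniteOfLRFibre.LocalResolutionNonClosedGe4Fibre` (Temkin 2.3.4 (iii) form: fibre-singular local blow-ups at NON-closed points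
of local dimension ≥ 4 admit desingularization) and (LF_cl) `LocalFullificationFibreClosedGe4.LocalFullificationFibreClosedGe4` (fibre-regular local blow-ups
at CLOSED points of local dimension `d ≥ 4` admit a fibre-supported FULL blowing up) — both OURS, conjecture-tagged, consumed as hypotheses only. ♭ twin of
res-L1-w45a-stub-1's `…OfLocalDoor` (p588… (LR)/(LF) version): the (LR)/(LF) theorem follows from this one by the two comparison lemmas
(`localResolutionNonClosedGe4Fibre_of_localResolutionNonClosedGe4`, `LocalFullificationFibreClosedGe4.…_of_…`). AI-written (AI review weaker than expert review).

* `fullBlowupGe4_of_localDoorWeak` — the FULL blow-up model in dimension ≥ 4: THEOREM A♭ (`RegularOffFiniteOfLRFibre.regularOffFinite_of_LRfibre`, this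
  seat) feeds res-L1-w45a-stub-2's dimension-free F-Temkin engine (`FTemkinClosedPointsLocal.exists_isBlowup_full_of_LFclosed_of_regularOffFinite`);
* `fiModel_integral_of_localDoorWeak`, `fInjectiveMacaulayfication_text_of_localDoorWeak` — integral form / the crux's ∀-text (res-L1-w45a-stub-1's
  `OfFullBlowupGe4` packaging: dimension ≤ 3 by Cossart–Piltant outright, reduced ↦ integral components);
* **`fInjectiveMacaulayfication_of_localDoorWeak (hG h081R hP) (hLR♭) (hLF_cl) : Theses.FrobeniusLadder.FInjectiveMacaulayfication`** — the route decl.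
[folklore assembly; cite: Temkin2008, Prop. 2.3.4 (iii)] [cite: CossartPiltant2019, Thm. 1.1 (i)(ii); Prop. 4.4] [cite: StacksProject, Tag 080B]
-/

-- single-problem summit: the doubled namespace component is forced
set_option linter.dupNamespace false

noncomputable section

namespace Summit.ResolutionOfSingularities.ResolutionOfSingularities.Theorems.FInjectiveMacaulayfication.OfLocalDoorWeak

open CategoryTheory CategoryTheory.Limits AlgebraicGeometry TopologicalSpace IsLocalRing
open Literature.AlgebraicGeometry.Resolution
open Summit.ResolutionOfSingularities.ResolutionOfSingularities.Theorems.FInjectiveMacaulayfication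
open SliceableCentre

/-- The weak (♭) local door supplies the FULL blow-up model in dimension `≥ 4` (the input shape of `OfFullBlowupGe4`). [OURS · conditional-result]
[cite: Temkin2008, Prop. 2.3.4 (iii)] [cite: CossartPiltant2019, Thm. 1.1 (i)(ii); Prop. 4.4] -/
theorem fullBlowupGe4_of_localDoorWeak
    (hG : CossartPiltant2019General.{0}) (h081R : Stacks081R.{0}) (hP : CossartPiltant2019Principalization.{0})
    (hLR : RegularOffFiniteOfLRFibre.LocalResolutionNonClosedGe4Fibre) (hLF : LocalFullificationFibreClosedGe4.LocalFullificationFibreClosedGe4)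
    (p : ℕ) (hp : p.Prime) :
    ∀ (k : Type) [Field k] [CharP k p] (X : Scheme.{0}) (f : X ⟶ Spec (.of k)),
      IsSeparated f → LocallyOfFiniteType f → QuasiCompact f → IsIntegral X → (4 : WithBot ℕ∞) ≤ topologicalKrullDim X →
      ∃ (X'' : Scheme.{0}) (f'' : X'' ⟶ X) (J'' : X.IdealSheafData), IsBlowup f'' J'' ∧ J'' ≠ ⊥ ∧
        ∀ x'' : X'', FullCl p (X''.presheaf.stalk x'') := by
  intro k _ _ X f hs hl hq hi hd
  haveI := hs
  haveI := hl
  haveI := hq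
  haveI := hi
  have h3 : (3 : WithBot ℕ∞) ≤ topologicalKrullDim X := le_trans (by norm_num) hd
  obtain ⟨X'', f'', J'', hf'', hJ'', -, hfull⟩ :=
    FTemkinClosedPointsLocal.exists_isBlowup_full_of_LFclosed_of_regularOffFinite (fun d h => hLF d h) p hp k X f hd
      (RegularOffFiniteOfLRFibre.regularOffFinite_of_LRfibre hG h081R hP hLR p hp k X f h3)
  exact ⟨X'', f'', J'', hf'', hJ'', hfull⟩

/-- **The crux's INTEGRAL FORM from the weak (♭) local door.** [OURS · conditional-result] [cite: CossartPiltant2019, Thm. 1.1 (i)(ii); Prop. 4.4] [cite: Temkin2008, Prop. 2.3.4 (iii)] -/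
theorem fiModel_integral_of_localDoorWeak
    (hG : CossartPiltant2019General.{0}) (h081R : Stacks081R.{0}) (hP : CossartPiltant2019Principalization.{0})
    (hLR : RegularOffFiniteOfLRFibre.LocalResolutionNonClosedGe4Fibre) (hLF : LocalFullificationFibreClosedGe4.LocalFullificationFibreClosedGe4)
    (p : ℕ) [hp : Fact p.Prime] (k : Type) [Field k] [CharP k p] (X : Scheme.{0}) (f : X ⟶ Spec (.of k))
    [IsSeparated f] [LocallyOfFiniteType f] [QuasiCompact f] [IsIntegral X] :
    ∃ (X' : Scheme.{0}) (π : X' ⟶ X), IsProper π ∧ IsBirational π ∧ IsIntegral X' ∧ ∀ x : X', FullCl p (X'.presheaf.stalk x) :=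
  OfFullBlowupGe4.fiModel_integral_of_fullBlowupGe4 hG p (fullBlowupGe4_of_localDoorWeak hG h081R hP hLR hLF p hp.out) k X f

/-- **The crux's ∀-TEXT VERBATIM from the weak (♭) local door.** [OURS · conditional-result] [cite: CossartPiltant2019, Thm. 1.1 (i)(ii); Prop. 4.4] [cite: Temkin2008, Prop. 2.3.4 (iii)] -/
theorem fInjectiveMacaulayfication_text_of_localDoorWeak
    (hG : CossartPiltant2019General.{0}) (h081R : Stacks081R.{0}) (hP : CossartPiltant2019Principalization.{0})
    (hLR : RegularOffFiniteOfLRFibre.LocalResolutionNonClosedGe4Fibre) (hLF : LocalFullificationFibreClosedGe4.LocalFullificationFibreClosedGe4) :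
    ∀ p : ℕ, p.Prime → ∀ (k : Type) [Field k] [CharP k p] (X : Scheme.{0}) (f : X ⟶ Spec (.of k)),
      IsSeparated f → LocallyOfFiniteType f → QuasiCompact f → IsReduced X →
      ∃ (X' : Scheme.{0}) (π : X' ⟶ X), IsProper π ∧ IsBirational π ∧ ∀ x : X',
        IsDomain (X'.presheaf.stalk x) ∧ ∀ d : ℕ, ringKrullDim (X'.presheaf.stalk x) = d →
          ∀ s : Fin d → X'.presheaf.stalk x, (Ideal.span (Set.range s)).radical.IsMaximal →
            RingTheory.Sequence.IsWeaklyRegular (X'.presheaf.stalk x) (List.ofFn s) ∧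
            ∀ y : X'.presheaf.stalk x, (∃ e : ℕ, y ^ p ^ e ∈ Ideal.span
              ((fun z : X'.presheaf.stalk x => z ^ p ^ e) ''
                (Ideal.span (Set.range s) : Set (X'.presheaf.stalk x)))) →
              y ∈ Ideal.span (Set.range s) :=
  OfFullBlowupGe4.fInjectiveMacaulayfication_text_of_fullBlowupGe4 hG
    (fun p hp => fullBlowupGe4_of_localDoorWeak hG h081R hP hLR hLF p hp)

/-- **★★ THE ROUTE DECL `Theses.FrobeniusLadder.FInjectiveMacaulayfication` FROM THE WEAK (♭) LOCAL DOOR** {CP 1.1, 081R, CP 4.4} ∧ (LR♭) ∧ (LF_cl) — door v36's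
`_proof` term on the weakest registered pair. [OURS · conditional-result] [cite: CossartPiltant2019, Thm. 1.1 (i)(ii); Prop. 4.4] [cite: Temkin2008, Prop. 2.3.4 (iii)] -/
theorem fInjectiveMacaulayfication_of_localDoorWeak
    (hG : CossartPiltant2019General.{0}) (h081R : Stacks081R.{0}) (hP : CossartPiltant2019Principalization.{0})
    (hLR : RegularOffFiniteOfLRFibre.LocalResolutionNonClosedGe4Fibre) (hLF : LocalFullificationFibreClosedGe4.LocalFullificationFibreClosedGe4) :
    Summit.ResolutionOfSingularities.ResolutionOfSingularities.Theses.FrobeniusLadder.FInjectiveMacaulayfication :=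
  OfFullBlowupGe4.fInjectiveMacaulayfication_of_fullBlowupGe4 hG (fun p hp => fullBlowupGe4_of_localDoorWeak hG h081R hP hLR hLF p hp)

end Summit.ResolutionOfSingularities.ResolutionOfSingularities.Theorems.FInjectiveMacaulayfication.OfLocalDoorWeak

end
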